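import Summits.QuantumFields.YangMills.Theorems.FradkinShenkerFlowPoincareToClusteringGeometry
import Summits.QuantumFields.YangMills.Theorems.FradkinShenkerFlowSusceptibilityToPoincareHaarResample
import Literature.MathematicalPhysics.QuantumLattice.TorusWilsonGibbs
import Literature.MathematicalPhysics.QuantumFieldTheory.LatticeGaugeDobrushinPoincare

/-!
# The single-link heat-bath kernel of the torus Wilson theory (support of `PoincareToClustering`)

Route `FradkinShenkerFlow` of `YangMills`, support item `stmt-QuantumFields-9444`
(`Summit.QuantumFields.YangMills.Theses.FradkinShenkerFlow.PoincareToClustering`, UP ⇒ EC).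
The proof of UP ⇒ EC runs the random-scan single-link heat-bath (Glauber) sampler of the torus
Wilson measure `μ = wilsonMeasure ρ β` in DISCRETE time. This file proves the basic properties
of the kernel objects of file `…Defs` (`hbLaw` = one-link heat-bath law, a probability measure;
`hbOp` = the heat-bath operator `E_ℓ`; `linkNbhd`):

* `hbLaw_congr`
  (LOCALITY: the law of `ℓ` depends on `U` only through `linkNbhd ℓ ∖ {ℓ}`, by the shadow/bulk
  splitting of the Wilson action of `LatticeGaugeProofs` and `tilted_const_add_eq` of
  `LatticeGaugeDobrushinPoincare`);
* elementary properties of `E_ℓ`: sup bound, it does not read the link `ℓ`, pull-out of factors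
  not reading `ℓ`, linearity, measurability (parametric tilted integral, `HaarResample`);
* `integral_integral_update_pi` — resampling one coordinate of the product Haar measure does not
  change the integral (the push-forward of `Haar^{⊗E} ⊗ Haar` under `(U, g) ↦ U[ℓ ↦ g]` is
  `Haar^{⊗E}`, `Measure.pi_eq`), and from it the DLR / INVARIANCE identity
  `integral_hbOp_wilsonMeasure`: `∫ E_ℓ h dμ = ∫ h dμ` (`wilsonMeasure_eq_tilted_pi`).

References: F. Martinelli, *Lectures on Glauber dynamics for discrete spin models*, LNM 1717
(1999), §2–3 (heat-bath dynamics, reversibility w.r.t. the Gibbs measure); H.-O. Georgii,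
*Gibbs Measures and Phase Transitions* (2011), Def. 1.23 (DLR consistency in finite volume).
-/

noncomputable section

open MeasureTheory ProbabilityTheory
open Literature.MathematicalPhysics.QuantumFieldTheory

namespace Summit.QuantumFields.YangMills.Theorems.PoincareClustering

/-! ### An abstract lemma on probability measures -/

/-- For a probability measure `κ` and a function `φ` all of whose values are within `c` of each
other, `|∫ φ dκ - φ k₀| ≤ c` for every `k₀` (bounded measurable `φ`). [folklore] -/
theorem abs_integral_sub_apply_le {K : Type*} [MeasurableSpace K] {κ : Measure K}
    [IsProbabilityMeasure κ] {φ : K → ℝ} (hφ : Integrable φ κ) {c : ℝ}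
    (hosc : ∀ k k', |φ k - φ k'| ≤ c) (k₀ : K) : |∫ k, φ k ∂κ - φ k₀| ≤ c := by
  have h1 : ∫ k, φ k ∂κ - φ k₀ = ∫ k, (φ k - φ k₀) ∂κ := by
    rw [integral_sub hφ (integrable_const _), integral_const, probReal_univ, one_smul]
  rw [h1]
  have h2 := norm_integral_le_of_norm_le_const (μ := κ) (f := fun k => φ k - φ k₀) (C := c)
    (ae_of_all _ fun k => by rw [Real.norm_eq_abs]; exact hosc k k₀)
  simpa only [Real.norm_eq_abs, probReal_univ, mul_one] using h2

section Algebra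

variable {d L N : ℕ} {G : Type*} [Group G] [NeZero L] (ρ : G →* Matrix (Fin N) (Fin N) ℂ) (β : ℝ)

/-! ### Locality of the one-link energy -/

/-- Two backgrounds agreeing on `linkNbhd ℓ ∖ {ℓ}` have the same shadow action after any common
resampling of `ℓ`. [folklore] -/
theorem shadowAction_update_congr {ℓ : Edge d L} {U V : GaugeConfig d L G}
    (hUV : ∀ e ∈ linkNbhd ℓ, e ≠ ℓ → U e = V e) (g : G) :
    shadowAction ρ (edgeShadow ({ℓ} : Finset (Edge d L))) (Function.update U ℓ g) =
      shadowAction ρ (edgeShadow ({ℓ} : Finset (Edge d L))) (Function.update V ℓ g) := by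
  unfold shadowAction
  refine Finset.sum_congr rfl fun p hp => ?_
  have hy : p.1 ∈ edgeShadow ({ℓ} : Finset (Edge d L)) := (Finset.mem_filter.1 hp).2
  have key : ∀ e ∈ linkNbhd ℓ, Function.update U ℓ g e = Function.update V ℓ g e := by
    intro e he
    by_cases h : e = ℓ
    · subst h
      simp only [Function.update_self]
    · rw [Function.update_of_ne h, Function.update_of_ne h, hUV e he h]
  unfold plaquetteCost plaquetteHolonomy
  rw [key (p.1, p.2.1.1) (mem_linkNbhd_base hy _), key (p.1.shift p.2.1.1, p.2.1.2)
      (mem_linkNbhd_shift hy _ _), key (p.1.shift p.2.1.2, p.2.1.1) (mem_linkNbhd_shift hy _ _),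
    key (p.1, p.2.1.2) (mem_linkNbhd_base hy _)]

/-- **Locality of the one-link energy**: two backgrounds agreeing on `linkNbhd ℓ ∖ {ℓ}` have
tilts `g ↦ S_W(·[ℓ ↦ g])` differing by a constant. [folklore] -/
theorem wilsonAction_update_eq_const_add {ℓ : Edge d L} {U V : GaugeConfig d L G}
    (hUV : ∀ e ∈ linkNbhd ℓ, e ≠ ℓ → U e = V e) :
    ∃ c : ℝ, ∀ g : G, wilsonAction ρ (Function.update U ℓ g) =
      c + wilsonAction ρ (Function.update V ℓ g) := by
  refine ⟨bulkAction ρ (edgeShadow ({ℓ} : Finset (Edge d L))) U -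
    bulkAction ρ (edgeShadow ({ℓ} : Finset (Edge d L))) V, fun g => ?_⟩
  have hU : ∀ e, e ∉ ({ℓ} : Finset (Edge d L)) → Function.update U ℓ g e = U e := fun e he =>
    Function.update_of_ne (fun h => he (Finset.mem_singleton.2 h)) _ _
  have hV : ∀ e, e ∉ ({ℓ} : Finset (Edge d L)) → Function.update V ℓ g e = V e := fun e he =>
    Function.update_of_ne (fun h => he (Finset.mem_singleton.2 h)) _ _
  rw [wilsonAction_eq_shadowAction_add_bulkAction ρ (edgeShadow ({ℓ} : Finset (Edge d L))),
    wilsonAction_eq_shadowAction_add_bulkAction ρ (edgeShadow ({ℓ} : Finset (Edge d L)))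
      (Function.update V ℓ g),
    shadowAction_update_congr ρ hUV g, bulkAction_congr ρ hU, bulkAction_congr ρ hV]
  ring

section Compact

variable [TopologicalSpace G] [CompactSpace G]

/-- The Boltzmann weight is bounded, uniformly on the torus (continuous `ρ`). [folklore] -/
theorem exists_bw_le (hρ : Continuous ρ) : ∃ B : ℝ, ∀ U : GaugeConfig d L G, |bw ρ β U| ≤ B := by
  obtain ⟨A, hA⟩ := exists_abs_wilsonAction_le (d := d) (L := L) (G := G) ρ hρ
  refine ⟨Real.exp (|β| * A), fun U => ?_⟩
  rw [bw, Real.abs_exp]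
  refine Real.exp_le_exp.2 ?_
  calc -β * wilsonAction ρ U ≤ |-β * wilsonAction ρ U| := le_abs_self _
    _ = |β| * |wilsonAction ρ U| := by rw [abs_mul, abs_neg]
    _ ≤ |β| * A := mul_le_mul_of_nonneg_left (hA _) (abs_nonneg β)

end Compact

section Meas

variable [TopologicalSpace G] [IsTopologicalGroup G] [MeasurableSpace G] [BorelSpace G]
  [SecondCountableTopology G]

/-- Joint measurability of the tilt `(U, g) ↦ -β S_W(U[ℓ ↦ g])`. [folklore] -/
theorem measurable_tilt (hρ : Continuous ρ) (ℓ : Edge d L) :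
    Measurable fun p : GaugeConfig d L G × G => -β * wilsonAction ρ (Function.update p.1 ℓ p.2) :=
  measurable_const.mul ((measurable_wilsonAction ρ hρ).comp measurable_update')

/-- The Boltzmann weight is measurable. [folklore] -/
theorem measurable_bw (hρ : Continuous ρ) : Measurable (bw (d := d) (L := L) (G := G) ρ β) :=
  ((measurable_wilsonAction ρ hρ).const_mul _).exp

end Meas

end Algebra

section HeatBath

variable {d L N : ℕ} {G : Type*} [Group G] [TopologicalSpace G] [IsTopologicalGroup G]
  [CompactSpace G] [MeasurableSpace G] [BorelSpace G] [NeZero L]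
  (ρ : G →* Matrix (Fin N) (Fin N) ℂ) (β : ℝ)

/-! ### The heat-bath law and the heat-bath operator of one link -/

/-- The heat-bath law does not read the link it resamples. [folklore] -/
theorem hbLaw_update (ℓ : Edge d L) (U : GaugeConfig d L G) (g₀ : G) :
    hbLaw ρ β ℓ (Function.update U ℓ g₀) = hbLaw ρ β ℓ U := by
  unfold hbLaw
  simp only [Function.update_idem]

/-- The heat-bath operator does not read the link it resamples. [folklore] -/
theorem hbOp_update (ℓ : Edge d L) (h : GaugeConfig d L G → ℝ) (U : GaugeConfig d L G) (g₀ : G) :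
    hbOp ρ β ℓ h (Function.update U ℓ g₀) = hbOp ρ β ℓ h U := by
  unfold hbOp
  rw [hbLaw_update]
  simp only [Function.update_idem]

/-- Pull-out: a factor that does not read the link `ℓ` comes out of `E_ℓ`. [folklore] -/
theorem hbOp_mul_left (ℓ : Edge d L) {k h : GaugeConfig d L G → ℝ}
    (hk : ∀ U g, k (Function.update U ℓ g) = k U) (U : GaugeConfig d L G) :
    hbOp ρ β ℓ (fun V => k V * h V) U = k U * hbOp ρ β ℓ h U := by
  unfold hbOp
  simp only [hk]
  exact integral_const_mul _ _

/-- `E_ℓ` in density form: `E_ℓ h (U) = Z_ℓ(U)⁻¹ ∫ e^{-βS(U[ℓ↦g])} h(U[ℓ↦g]) dHaar(g)`. [folklore] -/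
theorem hbOp_eq_density (ℓ : Edge d L) (h : GaugeConfig d L G → ℝ) (U : GaugeConfig d L G) :
    hbOp ρ β ℓ h U = (∫ g, bw ρ β (Function.update U ℓ g) ∂haarProbability G)⁻¹ *
      ∫ g, bw ρ β (Function.update U ℓ g) * h (Function.update U ℓ g) ∂haarProbability G := by
  unfold hbOp hbLaw
  rw [integral_tilted, ← integral_const_mul]
  refine integral_congr_ae (ae_of_all _ fun g => ?_)
  simp only [smul_eq_mul, exp_eq_bw]
  ring

/-! ### Locality of the heat-bath law -/

/-- **Locality of the heat-bath law**: `ν_ℓ^U = ν_ℓ^V` whenever `U` and `V` agree on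
`linkNbhd ℓ ∖ {ℓ}` (the Markov property of the nearest-plaquette interaction; Martinelli 1999
§2.1, finite-range Gibbs measures). [folklore] -/
theorem hbLaw_congr {ℓ : Edge d L} {U V : GaugeConfig d L G}
    (hUV : ∀ e ∈ linkNbhd ℓ, e ≠ ℓ → U e = V e) : hbLaw ρ β ℓ U = hbLaw ρ β ℓ V := by
  obtain ⟨c, hc⟩ := wilsonAction_update_eq_const_add ρ hUV
  unfold hbLaw
  have : (fun g' => -β * wilsonAction ρ (Function.update U ℓ g')) =
      fun g' => -β * c + -β * wilsonAction ρ (Function.update V ℓ g') := by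
    funext g'
    rw [hc g']
    ring
  rw [this, tilted_const_add_eq]

/-! ### Resampling one link of the product Haar measure; the DLR identity -/

/-- The push-forward of `Haar^{⊗ links} ⊗ Haar` under `(U, g) ↦ U[ℓ ↦ g]` is `Haar^{⊗ links}`
(both are product measures with the same factors; `Measure.pi_eq`). [folklore] -/
theorem map_update_pi_prod (ℓ : Edge d L) :
    ((Measure.pi fun _ : Edge d L => haarProbability G).prod (haarProbability G)).map
        (fun p : GaugeConfig d L G × G => Function.update p.1 ℓ p.2) =
      Measure.pi fun _ : Edge d L => haarProbability G := by
  refine (Measure.pi_eq fun s hs => ?_).symm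
  rw [Measure.map_apply measurable_update' (MeasurableSet.univ_pi hs)]
  have hpre : (fun p : GaugeConfig d L G × G => Function.update p.1 ℓ p.2) ⁻¹' Set.pi Set.univ s =
      Set.pi Set.univ (Function.update s ℓ Set.univ) ×ˢ s ℓ := by
    ext p
    simp only [Set.mem_preimage, Set.mem_univ_pi, Set.mem_prod]
    constructor
    · intro h
      refine ⟨fun i => ?_, ?_⟩
      · by_cases hi : i = ℓ
        · subst hi
          simp only [Function.update_self, Set.mem_univ]
        · have := h i
          rw [Function.update_of_ne hi] at this
          rw [Function.update_of_ne hi]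
          exact this
      · have := h ℓ
        rwa [Function.update_self] at this
    · rintro ⟨h1, h2⟩ i
      by_cases hi : i = ℓ
      · subst hi
        rwa [Function.update_self]
      · have := h1 i
        rw [Function.update_of_ne hi] at this
        rw [Function.update_of_ne hi]
        exact this
  rw [hpre, Measure.prod_prod, Measure.pi_pi,
    ← Finset.prod_erase_mul Finset.univ _ (Finset.mem_univ ℓ),
    ← Finset.prod_erase_mul Finset.univ (fun i => haarProbability G (s i)) (Finset.mem_univ ℓ)]
  simp only [Function.update_self, measure_univ, mul_one]
  congr 1
  exact Finset.prod_congr rfl fun i hi => by rw [Function.update_of_ne (Finset.ne_of_mem_erase hi)]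

/-- **Resampling one link of product Haar measure does not change the integral**:
`∫ F dHaar^{⊗E} = ∫∫ F(U[ℓ ↦ g]) dHaar(g) dHaar^{⊗E}(U)` for bounded measurable `F`. [folklore] -/
theorem integral_integral_update_pi (ℓ : Edge d L) {F : GaugeConfig d L G → ℝ}
    (hF : Measurable F) {M : ℝ} (hM : ∀ U, |F U| ≤ M) :
    ∫ U, ∫ g, F (Function.update U ℓ g) ∂haarProbability G
        ∂(Measure.pi fun _ : Edge d L => haarProbability G) =
      ∫ U, F U ∂(Measure.pi fun _ : Edge d L => haarProbability G) := by
  set π : Measure (GaugeConfig d L G) := Measure.pi fun _ : Edge d L => haarProbability G with hπ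
  have hint : Integrable (Function.uncurry fun (U : GaugeConfig d L G) (g : G) =>
      F (Function.update U ℓ g)) (π.prod (haarProbability G)) :=
    Integrable.of_bound (hF.comp measurable_update').aestronglyMeasurable M
      (ae_of_all _ fun p => by rw [Real.norm_eq_abs]; exact hM _)
  calc ∫ U, ∫ g, F (Function.update U ℓ g) ∂haarProbability G ∂π
      = ∫ p, F (Function.update p.1 ℓ p.2) ∂(π.prod (haarProbability G)) := integral_integral hint
    _ = ∫ U, F U ∂((π.prod (haarProbability G)).map
          (fun p : GaugeConfig d L G × G => Function.update p.1 ℓ p.2)) :=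
        (integral_map measurable_update'.aemeasurable hF.aestronglyMeasurable).symm
    _ = ∫ U, F U ∂π := by rw [hπ, map_update_pi_prod]

section Continuous

variable [SecondCountableTopology G]

/-- The Boltzmann factor of the tilt is Haar integrable. [folklore] -/
theorem integrable_exp_tilt (hρ : Continuous ρ) (ℓ : Edge d L) (U : GaugeConfig d L G) :
    Integrable (fun g : G => Real.exp (-β * wilsonAction ρ (Function.update U ℓ g)))
      (haarProbability G) := by
  obtain ⟨B, hB⟩ := exists_bw_le (d := d) (L := L) (G := G) ρ β hρ
  refine Integrable.of_bound
    (Real.measurable_exp.comp ((measurable_tilt ρ β hρ ℓ).comp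
      (measurable_prodMk_left (x := U)))).aestronglyMeasurable B (ae_of_all _ fun g => ?_)
  rw [Real.norm_eq_abs]
  exact hB _

/-- The heat-bath law is a probability measure. [folklore] -/
theorem isProbabilityMeasure_hbLaw (hρ : Continuous ρ) (ℓ : Edge d L) (U : GaugeConfig d L G) :
    IsProbabilityMeasure (hbLaw ρ β ℓ U) :=
  isProbabilityMeasure_tilted (integrable_exp_tilt ρ β hρ ℓ U)

/-- A bounded measurable observable, read after resampling `ℓ`, is integrable for the heat-bath
law. [folklore] -/
theorem integrable_comp_update (hρ : Continuous ρ) (ℓ : Edge d L) (U : GaugeConfig d L G)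
    {h : GaugeConfig d L G → ℝ} (hh : Measurable h) {M : ℝ} (hM : ∀ V, |h V| ≤ M) :
    Integrable (fun g => h (Function.update U ℓ g)) (hbLaw ρ β ℓ U) := by
  haveI := isProbabilityMeasure_hbLaw ρ β hρ ℓ U
  exact Integrable.of_bound (hh.comp (measurable_update U)).aestronglyMeasurable M
    (ae_of_all _ fun g => by rw [Real.norm_eq_abs]; exact hM _)

/-- Sup bound: `|E_ℓ h| ≤ M` if `|h| ≤ M`. [folklore] -/
theorem abs_hbOp_le (hρ : Continuous ρ) (ℓ : Edge d L) {h : GaugeConfig d L G → ℝ} {M : ℝ}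
    (hM : ∀ V, |h V| ≤ M) (U : GaugeConfig d L G) : |hbOp ρ β ℓ h U| ≤ M := by
  unfold hbOp hbLaw
  have := SusceptibilityToPoincare.HaarResample.norm_integral_tilted_le (κ := haarProbability G)
    (integrable_exp_tilt ρ β hρ ℓ U) (ψ := fun g => h (Function.update U ℓ g)) (B := M)
    (fun g => by rw [Real.norm_eq_abs]; exact hM _)
  simpa only [Real.norm_eq_abs] using this

/-- `|h - E_ℓ h| ≤ c` pointwise if `h` oscillates by at most `c` along the link `ℓ`. [folklore] -/
theorem abs_sub_hbOp_le (hρ : Continuous ρ) (ℓ : Edge d L) {h : GaugeConfig d L G → ℝ}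
    (hh : Measurable h) {M : ℝ} (hM : ∀ V, |h V| ≤ M) {c : ℝ}
    (hosc : ∀ V g, |h (Function.update V ℓ g) - h V| ≤ c) (U : GaugeConfig d L G) :
    |h U - hbOp ρ β ℓ h U| ≤ c := by
  haveI := isProbabilityMeasure_hbLaw ρ β hρ ℓ U
  have hosc' : ∀ g g' : G, |h (Function.update U ℓ g) - h (Function.update U ℓ g')| ≤ c :=
    fun g g' => by
      have := hosc (Function.update U ℓ g') g
      rwa [Function.update_idem] at this
  have h1 := abs_integral_sub_apply_le (integrable_comp_update ρ β hρ ℓ U hh hM) hosc' (U ℓ)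
  rw [Function.update_eq_self] at h1
  rw [abs_sub_comm]
  exact h1

/-- `E_ℓ h` is measurable for measurable `h` (parametric tilted integral). [folklore] -/
theorem measurable_hbOp (hρ : Continuous ρ) (ℓ : Edge d L) {h : GaugeConfig d L G → ℝ}
    (hh : Measurable h) : Measurable (hbOp ρ β ℓ h) := by
  unfold hbOp hbLaw
  exact SusceptibilityToPoincare.HaarResample.measurable_integral_tilted (κ := haarProbability G)
    (f := fun U g => -β * wilsonAction ρ (Function.update U ℓ g))
    (ψ := fun U g => h (Function.update U ℓ g)) (measurable_tilt ρ β hρ ℓ)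
    (hh.comp measurable_update')

/-- The weighted DLR identity on product Haar measure:
`∫ e^{-βS} E_ℓ h dHaar^{⊗E} = ∫ e^{-βS} h dHaar^{⊗E}`. [folklore] -/
theorem integral_bw_mul_hbOp_pi (hρ : Continuous ρ) (ℓ : Edge d L)
    {h : GaugeConfig d L G → ℝ} (hh : Measurable h) {M : ℝ} (hM : ∀ V, |h V| ≤ M) :
    ∫ U, bw ρ β U * hbOp ρ β ℓ h U ∂(Measure.pi fun _ : Edge d L => haarProbability G) =
      ∫ U, bw ρ β U * h U ∂(Measure.pi fun _ : Edge d L => haarProbability G) := by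
  set π : Measure (GaugeConfig d L G) := Measure.pi fun _ : Edge d L => haarProbability G with hπ
  obtain ⟨B, hB⟩ := exists_bw_le (d := d) (L := L) (G := G) ρ β hρ
  have hB0 : 0 ≤ B := (abs_nonneg _).trans (hB (Classical.arbitrary _))
  have hM0 : 0 ≤ M := (abs_nonneg _).trans (hM (Classical.arbitrary _))
  -- the two functions we resample
  have hF1m : Measurable fun V => bw ρ β V * hbOp ρ β ℓ h V :=
    (measurable_bw ρ β hρ).mul (measurable_hbOp ρ β hρ ℓ hh)
  have hF1b : ∀ V, |bw ρ β V * hbOp ρ β ℓ h V| ≤ B * M := fun V => by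
    rw [abs_mul]
    exact mul_le_mul (hB V) (abs_hbOp_le ρ β hρ ℓ hM V) (abs_nonneg _) hB0
  have hF2m : Measurable fun V => bw ρ β V * h V := (measurable_bw ρ β hρ).mul hh
  have hF2b : ∀ V, |bw ρ β V * h V| ≤ B * M := fun V => by
    rw [abs_mul]
    exact mul_le_mul (hB V) (hM V) (abs_nonneg _) hB0
  rw [← integral_integral_update_pi ℓ hF1m hF1b, ← integral_integral_update_pi ℓ hF2m hF2b]
  refine integral_congr_ae (ae_of_all _ fun U => ?_)
  -- pointwise in `U`: `∫ bw(U^g) E_ℓ h(U^g) dg = E_ℓ h(U) Z_ℓ(U) = ∫ bw(U^g) h(U^g) dg`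
  have hZ : 0 < ∫ g, bw ρ β (Function.update U ℓ g) ∂haarProbability G :=
    integral_exp_pos (integrable_exp_tilt ρ β hρ ℓ U)
  have hZ0 : (∫ g, bw ρ β (Function.update U ℓ g) ∂haarProbability G) ≠ 0 := hZ.ne'
  simp only [hbOp_update]
  rw [integral_mul_const, hbOp_eq_density]
  field_simp

/-- **DLR / invariance of the heat bath**: resampling any link from its conditional law leaves
the torus Wilson measure invariant, `∫ E_ℓ h dμ_{Λ,β} = ∫ h dμ_{Λ,β}` for bounded measurable `h`
(Georgii 2011 Def. 1.23, consistency of the one-point kernels; Martinelli 1999 §2.3,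
reversibility of the heat bath). [folklore] -/
theorem integral_hbOp_wilsonMeasure (hρ : Continuous ρ) (ℓ : Edge d L)
    {h : GaugeConfig d L G → ℝ} (hh : Measurable h) {M : ℝ} (hM : ∀ V, |h V| ≤ M) :
    ∫ U, hbOp ρ β ℓ h U ∂(wilsonMeasure (d := d) (L := L) ρ β) =
      ∫ U, h U ∂(wilsonMeasure (d := d) (L := L) ρ β) := by
  rw [Literature.MathematicalPhysics.QuantumLattice.wilsonMeasure_eq_tilted_pi ρ hρ β,
    integral_tilted, integral_tilted]
  simp only [smul_eq_mul, exp_eq_bw, div_eq_inv_mul, mul_assoc]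
  rw [integral_const_mul, integral_const_mul, integral_bw_mul_hbOp_pi ρ β hρ ℓ hh hM]

end Continuous

end HeatBath

end Summit.QuantumFields.YangMills.Theorems.PoincareClustering

end
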